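import Mathlib.NumberTheory.Real.GoldenRatio
import Mathlib.Analysis.Analytic.IsolatedZeros
import Mathlib.Analysis.Analytic.Constructions
import Mathlib.Analysis.SpecificLimits.Basic
import Mathlib.Analysis.Complex.Basic
import Mathlib.Analysis.Calculus.Deriv.Mul
import HarnessLib

/-!
# Rigidity of cusp hits on golden (Lucas) abscissae

Companion of `GeometricHitRigidity.lean` (geometric abscissae) and `GoldenGermLogDensity.lean` (the
golden germ, the extremal ALGEBRAIC example of a "jet + tail" function `h(N) = αN + α₀ + g(1/N)` with
`≍ log X` integer hits, namely at the even Fibonacci numbers `F₂ₘ`). Here we prove that this example is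
ISOLATED on its own abscissae:

* `golden_rigidity`: let `p ≥ 1`, `α, α₀ ∈ ℂ` be ANY linear jet and `g` ANY tail analytic at `0` with
  `g 0 = 0`. If for infinitely many `m` the FOUR numbers `F₂ₘ, F₂₍ₘ₊ₚ₎, F₂₍ₘ₊₂ₚ₎, F₂₍ₘ₊₃ₚ₎` are all hits
  (`αN + α₀ + g(1/N) ∈ ℤ`), then `g ∘ z = κ·id` near `0` for some `κ ∈ ℂ`, where
  `z(u) = √5·u/(1 − u²)` is the golden abscissa map (`z(ψ²ⁿ) = 1/F₂ₙ`). Equivalently `g = κ·goldenGerm`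
  near `0` (the inverse of `z` is the golden germ `(√(5 + 4σ²) − √5)/(2σ)`), an ALGEBRAIC function: so a
  TRANSCENDENTAL tail admits only finitely many such 4-progressions of Fibonacci hits for every `p`, and
  (Szemerédi) its hits occupy an index set `{m : F₂ₘ hit}` of upper density `0`.

Mechanism (integer Lucas third difference; we could not find it in print — folklore in spirit):
with `q = ψ²ᵖ = φ⁻²ᵖ` and the Lucas number `L = L₂ₚ = φ²ᵖ + ψ²ᵖ ∈ ℤ`, the coefficients of
`Λ(T) = (T − 1)(T² − L·T + 1) = T³ − (L+1)T² + (L+1)T − 1 ∈ ℤ[T]` kill exactly the monomials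
`u⁻¹, u⁰, u¹` of a Laurent series in `u = ψ²ᵐ`; the jet `αF₂₍ₘ₊ᵣₚ₎ + α₀` lives in those monomials (Binet),
so `Ξ(u) := Σᵣ λᵣ·g(z(u qʳ))` is an INTEGER at `u = ψ²ᵐ` for the good `m`, tends to `0`, hence vanishes
identically (identity theorem); subtracting `κu` (`κ = (g ∘ z)'(0)`, also killed by `Λ`) the first
surviving Taylor coefficient `n ≥ 2` would need `Λ(qⁿ) = 0`, i.e. `qⁿ ∈ {1, q, q⁻¹}` — impossible.
-/

namespace Literature.NumberTheory.Transcendental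

open Filter
open _root_.Topology
open scoped goldenRatio

noncomputable section

/-! ## Golden constants -/

/-- `2φ − 1 = √5`. [folklore] -/
theorem two_mul_goldenRatio_sub_one : 2 * φ - 1 = Real.sqrt 5 := by
  rw [Real.goldenRatio]; ring

/-- `2ψ − 1 = −√5`. [folklore] -/
theorem two_mul_goldenConj_sub_one : 2 * ψ - 1 = -Real.sqrt 5 := by
  rw [Real.goldenConj]; ring

/-- `φ²·ψ² = 1`. [folklore] -/
theorem goldenRatio_sq_mul_goldenConj_sq : φ ^ 2 * ψ ^ 2 = 1 := by
  rw [← mul_pow, Real.goldenRatio_mul_goldenConj]; norm_num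

/-- `0 < ψ² < 1`. [folklore] -/
theorem goldenConj_sq_pos : 0 < ψ ^ 2 := by
  have h : ψ < 0 := Real.goldenConj_neg
  nlinarith

/-- `ψ² < 1`. [folklore] -/
theorem goldenConj_sq_lt_one : ψ ^ 2 < 1 := by
  have h1 : -1 < ψ := Real.neg_one_lt_goldenConj
  have h2 : ψ < 0 := Real.goldenConj_neg
  nlinarith

/-- The even Lucas number `L₂ₚ = 2F₂ₚ₊₁ − F₂ₚ` as an integer. [folklore] -/
def lucasEven (p : ℕ) : ℤ := 2 * (Nat.fib (2 * p + 1) : ℤ) - (Nat.fib (2 * p) : ℤ)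

/-- Binet for the even Lucas numbers: `L₂ₚ = φ²ᵖ + ψ²ᵖ` (in `ℂ`). [folklore] -/
theorem lucasEven_cast (p : ℕ) : (lucasEven p : ℂ) = ((φ : ℝ) : ℂ) ^ (2 * p) + ((ψ : ℝ) : ℂ) ^ (2 * p) := by
  have h1 := Real.coe_fib_eq (2 * p + 1)
  have h2 := Real.coe_fib_eq (2 * p)
  have h5 : Real.sqrt 5 ≠ 0 := (Real.sqrt_pos.mpr (by norm_num)).ne'
  have key : (lucasEven p : ℝ) = φ ^ (2 * p) + ψ ^ (2 * p) := by
    simp only [lucasEven, Int.cast_sub, Int.cast_mul, Int.cast_ofNat, Int.cast_natCast, h1, h2]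
    have e1 : φ ^ (2 * p + 1) = φ ^ (2 * p) * φ := pow_succ _ _
    have e2 : ψ ^ (2 * p + 1) = ψ ^ (2 * p) * ψ := pow_succ _ _
    rw [e1, e2]
    field_simp
    have hφ := two_mul_goldenRatio_sub_one
    have hψ := two_mul_goldenConj_sub_one
    linear_combination (φ ^ (2 * p)) * hφ - (ψ ^ (2 * p)) * hψ
  have := congrArg (fun x : ℝ => (x : ℂ)) key
  push_cast at this ⊢
  exact this

/-- Binet in `ℂ`: `Fₙ = (φⁿ − ψⁿ)/√5`. [folklore] -/
theorem fib_cast_complex (n : ℕ) :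
    ((Nat.fib n : ℂ)) = (((φ : ℝ) : ℂ) ^ n - ((ψ : ℝ) : ℂ) ^ n) / ((Real.sqrt 5 : ℝ) : ℂ) := by
  have h := Real.coe_fib_eq n
  exact_mod_cast h

/-! ## The golden abscissa map `z(u) = √5·u/(1 − u²)` -/

/-- The golden abscissa map `z(u) = √5·u/(1 − u²)`; `z(ψ²ⁿ) = 1/F₂ₙ`. Its local inverse at `0` is the
golden germ `(√(5 + 4σ²) − √5)/(2σ)`. [folklore] -/
def goldenZ (u : ℂ) : ℂ := ((Real.sqrt 5 : ℝ) : ℂ) * u / (1 - u ^ 2)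

/-- `z(0) = 0`. [folklore] -/
theorem goldenZ_zero : goldenZ 0 = 0 := by simp [goldenZ]

/-- `z` is analytic at `0`. [folklore] -/
theorem analyticAt_goldenZ : AnalyticAt ℂ goldenZ 0 := by
  unfold goldenZ
  refine (analyticAt_const.mul analyticAt_id).div (analyticAt_const.sub (analyticAt_id.pow 2)) ?_
  simp

/-- `u ↦ g(z(u·a))` is analytic at `0` when `g` is. [folklore] -/
theorem analyticAt_comp_goldenZ_mul {g : ℂ → ℂ} (hg : AnalyticAt ℂ g 0) (a : ℂ) :
    AnalyticAt ℂ (fun u => g (goldenZ (u * a))) 0 := by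
  have h1 : AnalyticAt ℂ (fun u : ℂ => u * a) 0 := analyticAt_id.mul analyticAt_const
  have h2 : AnalyticAt ℂ (fun u : ℂ => goldenZ (u * a)) 0 :=
    analyticAt_goldenZ.comp_of_eq h1 (by simp)
  exact hg.comp_of_eq h2 (by simp [goldenZ_zero])

/-- **Binet on the abscissae**: `z(ψ²ⁿ) = 1/F₂ₙ` for `n ≥ 1`. [folklore] -/
theorem goldenZ_goldenConj_pow (n : ℕ) (hn : 1 ≤ n) :
    goldenZ (((ψ : ℝ) : ℂ) ^ (2 * n)) = ((Nat.fib (2 * n) : ℂ))⁻¹ := by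
  set P : ℂ := ((φ : ℝ) : ℂ) ^ (2 * n) with hP
  set Q : ℂ := ((ψ : ℝ) : ℂ) ^ (2 * n) with hQ
  have hPQ : P * Q = 1 := by
    have h := congrArg (fun x : ℝ => ((x : ℂ)) ^ n) goldenRatio_sq_mul_goldenConj_sq
    simp only [Complex.ofReal_mul, Complex.ofReal_pow, Complex.ofReal_one, one_pow, mul_pow,
      ← pow_mul] at h
    rw [hP, hQ]
    exact h
  have h5 : ((Real.sqrt 5 : ℝ) : ℂ) ≠ 0 := by
    exact_mod_cast (Real.sqrt_pos.mpr (by norm_num : (0:ℝ) < 5)).ne'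
  have hF : ((Nat.fib (2 * n) : ℂ)) = (P - Q) / ((Real.sqrt 5 : ℝ) : ℂ) := by
    rw [fib_cast_complex]
  have hFpos : ((Nat.fib (2 * n) : ℂ)) ≠ 0 := by
    exact_mod_cast (Nat.fib_pos.mpr (by omega)).ne'
  have hPQ' : P - Q ≠ 0 := by
    intro h
    apply hFpos
    rw [hF, h, zero_div]
  have hQ0 : Q ≠ 0 := by
    rw [hQ]; exact pow_ne_zero _ (by exact_mod_cast Real.goldenConj_ne_zero)
  have hden : (1 : ℂ) - Q ^ 2 ≠ 0 := by
    have : (1 : ℂ) - Q ^ 2 = Q * (P - Q) := by linear_combination (-1 : ℂ) * hPQ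
    rw [this]; exact mul_ne_zero hQ0 hPQ'
  show ((Real.sqrt 5 : ℝ) : ℂ) * Q / (1 - Q ^ 2) = ((Nat.fib (2 * n) : ℂ))⁻¹
  rw [hF, inv_div, div_eq_div_iff hden hPQ']
  linear_combination (((Real.sqrt 5 : ℝ) : ℂ)) * hPQ

/-! ## The Lucas third difference -/

/-- The golden (Lucas) third difference of `G` at ratio `q` with Lucas parameter `L`:
`Ξ G u = G(u q³) − (L + 1)·G(u q²) + (L + 1)·G(u q) − G(u)` — the coefficients of
`(T − 1)(T² − L T + 1)`. [folklore] -/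
def goldenThirdDiff (L q : ℂ) (G : ℂ → ℂ) : ℂ → ℂ :=
  fun u => G (u * q ^ 3) - (L + 1) * G (u * q ^ 2) + (L + 1) * G (u * q) - G u

/-- `Ξ` of an analytic `G` is analytic at `0`. [folklore] -/
theorem analyticAt_goldenThirdDiff (L q : ℂ) {G : ℂ → ℂ} (hG : AnalyticAt ℂ G 0) :
    AnalyticAt ℂ (goldenThirdDiff L q G) 0 := by
  have h : ∀ a : ℂ, AnalyticAt ℂ (fun u => G (u * a)) 0 := fun a =>
    hG.comp_of_eq (analyticAt_id.mul analyticAt_const) (by simp)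
  unfold goldenThirdDiff
  exact (((h _).sub (analyticAt_const.mul (h _))).add (analyticAt_const.mul (h _))).sub hG

/-- `Ξ G 0 = 0`. [folklore] -/
theorem goldenThirdDiff_zero (L q : ℂ) (G : ℂ → ℂ) : goldenThirdDiff L q G 0 = 0 := by
  simp [goldenThirdDiff]

/-- `Ξ` is linear: it kills `u ↦ κu` when `Λ(q) = (q − 1)(q² − Lq + 1) = 0`. [folklore] -/
theorem goldenThirdDiff_sub_linear (L q κ : ℂ) (G : ℂ → ℂ) (hΛ : (q - 1) * (q ^ 2 - L * q + 1) = 0)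
    (u : ℂ) : goldenThirdDiff L q (fun w => G w - κ * w) u = goldenThirdDiff L q G u := by
  simp only [goldenThirdDiff]
  linear_combination (-κ * u) * hΛ

/-! ## Step 1: Fibonacci 4-progressions of hits kill `Ξ` -/

/-- **The jet cancels (Binet)**: with `q = ψ²ᵖ`, `L = L₂ₚ`, `u = ψ²ᵐ` (`m ≥ 1`) and four hits at
`F₂₍ₘ₊ᵣₚ₎`, `r = 0,…,3`, the third difference of `g ∘ z` at `u` is the INTEGER
`L₃' − (L+1)L₂' + (L+1)L₁' − L₀'`. [folklore] -/
theorem goldenThirdDiff_sample_eq_int (p m : ℕ) (hm : 1 ≤ m) (α α₀ : ℂ) (g : ℂ → ℂ)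
    (Lr : ℕ → ℤ)
    (hhit : ∀ r : ℕ, r ≤ 3 → α * (Nat.fib (2 * (m + r * p)) : ℂ) + α₀ +
      g ((Nat.fib (2 * (m + r * p)) : ℂ))⁻¹ = Lr r) :
    goldenThirdDiff (lucasEven p : ℂ) (((ψ : ℝ) : ℂ) ^ (2 * p)) (fun u => g (goldenZ u))
        (((ψ : ℝ) : ℂ) ^ (2 * m)) =
      ((Lr 3 - (lucasEven p + 1) * Lr 2 + (lucasEven p + 1) * Lr 1 - Lr 0 : ℤ) : ℂ) := by
  -- abbreviations
  set x : ℂ := ((φ : ℝ) : ℂ) ^ (2 * p) with hx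
  set y : ℂ := ((ψ : ℝ) : ℂ) ^ (2 * p) with hy
  set P : ℂ := ((φ : ℝ) : ℂ) ^ (2 * m) with hP
  set Q : ℂ := ((ψ : ℝ) : ℂ) ^ (2 * m) with hQ
  have hφψ : ((φ : ℝ) : ℂ) ^ 2 * ((ψ : ℝ) : ℂ) ^ 2 = 1 := by
    have h := congrArg (fun t : ℝ => (t : ℂ)) goldenRatio_sq_mul_goldenConj_sq
    simp only [Complex.ofReal_mul, Complex.ofReal_pow, Complex.ofReal_one] at h
    exact h
  have hxy : x * y = 1 := by
    rw [hx, hy, pow_mul, pow_mul, ← mul_pow, hφψ, one_pow]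
  have hL : (lucasEven p : ℂ) = x + y := lucasEven_cast p
  have h5 : ((Real.sqrt 5 : ℝ) : ℂ) ≠ 0 := by
    exact_mod_cast (Real.sqrt_pos.mpr (by norm_num : (0:ℝ) < 5)).ne'
  -- sample points: `Q · yʳ = ψ^{2(m + r p)}` and `z` of it is `1/F`
  have hpt : ∀ r : ℕ, Q * y ^ r = ((ψ : ℝ) : ℂ) ^ (2 * (m + r * p)) := fun r => by
    rw [hQ, hy, ← pow_mul, ← pow_add]; ring_nf
  have hz : ∀ r : ℕ, goldenZ (Q * y ^ r) = ((Nat.fib (2 * (m + r * p)) : ℂ))⁻¹ := fun r => by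
    rw [hpt r]; exact goldenZ_goldenConj_pow (m + r * p) (by omega)
  -- Binet for the four Fibonacci numbers
  have hfib : ∀ r : ℕ, ((Nat.fib (2 * (m + r * p)) : ℂ)) =
      (P * x ^ r - Q * y ^ r) / ((Real.sqrt 5 : ℝ) : ℂ) := fun r => by
    rw [fib_cast_complex, hP, hQ, hx, hy]
    ring
  -- values of `g` at the four points, from the hits
  have hg : ∀ r : ℕ, r ≤ 3 → g (goldenZ (Q * y ^ r)) =
      Lr r - α * ((P * x ^ r - Q * y ^ r) / ((Real.sqrt 5 : ℝ) : ℂ)) - α₀ := fun r hr => by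
    rw [hz r, ← hfib r]
    linear_combination hhit r hr
  have hg0' : g (goldenZ Q) = Lr 0 - α * ((P - Q) / ((Real.sqrt 5 : ℝ) : ℂ)) - α₀ := by
    have h := hg 0 (by norm_num)
    simp only [pow_zero, mul_one] at h
    exact h
  have hg1' : g (goldenZ (Q * y)) = Lr 1 - α * ((P * x - Q * y) / ((Real.sqrt 5 : ℝ) : ℂ)) - α₀ := by
    have h := hg 1 (by norm_num)
    simp only [pow_one] at h
    exact h
  simp only [goldenThirdDiff]
  rw [hg 3 (by norm_num), hg 2 (by norm_num), hg1', hg0']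
  push_cast
  simp only [hL]
  linear_combination (α / ((Real.sqrt 5 : ℝ) : ℂ) * (P * (x - 1) - Q * (y - 1))) * hxy

/-- The samples `ψ²ᵐ` tend to `0` avoiding `0`. [folklore] -/
theorem tendsto_goldenConj_pow :
    Tendsto (fun m : ℕ => ((ψ : ℝ) : ℂ) ^ (2 * m)) atTop (𝓝[≠] 0) := by
  have h1 : Tendsto (fun m : ℕ => (((ψ : ℝ) : ℂ) ^ 2) ^ m) atTop (𝓝 0) := by
    apply tendsto_pow_atTop_nhds_zero_of_norm_lt_one
    rw [norm_pow, Complex.norm_real, Real.norm_eq_abs, sq_abs]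
    exact goldenConj_sq_lt_one
  refine tendsto_nhdsWithin_iff.mpr ⟨?_, Eventually.of_forall fun m => ?_⟩
  · simpa [← pow_mul] using h1
  · exact pow_ne_zero _ (by exact_mod_cast Real.goldenConj_ne_zero)

/-- **Step 1.** Infinitely many Fibonacci 4-progressions of hits (common index difference `p`) force
`Ξ (g ∘ z) ≡ 0` near `0`. [folklore] -/
theorem goldenThirdDiff_eventually_zero (p : ℕ) (α α₀ : ℂ) {g : ℂ → ℂ} (hg : AnalyticAt ℂ g 0)
    (hS : ∃ᶠ m : ℕ in atTop, ∀ r : ℕ, r ≤ 3 → ∃ L : ℤ,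
      α * (Nat.fib (2 * (m + r * p)) : ℂ) + α₀ + g ((Nat.fib (2 * (m + r * p)) : ℂ))⁻¹ = L) :
    ∀ᶠ u in 𝓝 (0 : ℂ),
      goldenThirdDiff (lucasEven p : ℂ) (((ψ : ℝ) : ℂ) ^ (2 * p)) (fun u => g (goldenZ u)) u = 0 := by
  set Ξ := goldenThirdDiff (lucasEven p : ℂ) (((ψ : ℝ) : ℂ) ^ (2 * p)) (fun u => g (goldenZ u))
    with hΞdef
  set t : ℕ → ℂ := fun m => ((ψ : ℝ) : ℂ) ^ (2 * m) with htdef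
  have hG : AnalyticAt ℂ (fun u => g (goldenZ u)) 0 := by
    simpa using analyticAt_comp_goldenZ_mul hg 1
  have hΞan : AnalyticAt ℂ Ξ 0 := analyticAt_goldenThirdDiff _ _ hG
  have ht : Tendsto t atTop (𝓝[≠] 0) := tendsto_goldenConj_pow
  have ht0 : Tendsto t atTop (𝓝 0) := ht.mono_right nhdsWithin_le_nhds
  have hΞt : Tendsto (fun m => Ξ (t m)) atTop (𝓝 0) := by
    have h := hΞan.continuousAt.tendsto.comp ht0
    have hΞ0 : Ξ 0 = 0 := goldenThirdDiff_zero _ _ _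
    rw [hΞ0] at h
    exact h
  have hsmall : ∀ᶠ m in atTop, ‖Ξ (t m)‖ < 1 := by
    have h := hΞt.norm
    rw [norm_zero] at h
    exact h.eventually (gt_mem_nhds zero_lt_one)
  have hzero : ∀ᶠ m : ℕ in atTop,
      (∀ r : ℕ, r ≤ 3 → ∃ L : ℤ,
        α * (Nat.fib (2 * (m + r * p)) : ℂ) + α₀ + g ((Nat.fib (2 * (m + r * p)) : ℂ))⁻¹ = L) →
      Ξ (t m) = 0 := by
    filter_upwards [hsmall, eventually_ge_atTop 1] with m hm hm1 hhit
    choose! Lr hLr using hhit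
    have hval : Ξ (t m) =
        ((Lr 3 - (lucasEven p + 1) * Lr 2 + (lucasEven p + 1) * Lr 1 - Lr 0 : ℤ) : ℂ) :=
      goldenThirdDiff_sample_eq_int p m hm1 α α₀ g Lr hLr
    have hlt : |(Lr 3 - (lucasEven p + 1) * Lr 2 + (lucasEven p + 1) * Lr 1 - Lr 0 : ℤ)| < 1 := by
      rw [hval, Complex.norm_intCast] at hm
      exact_mod_cast hm
    rw [hval, Int.abs_lt_one_iff.mp hlt, Int.cast_zero]
  have hfreq0 : ∃ᶠ u in 𝓝[≠] (0 : ℂ), Ξ u = 0 := ht.frequently (hS.mp hzero)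
  exact hΞan.frequently_zero_iff_eventually_zero.mp hfreq0

/-! ## Step 2: `Ξ G ≡ 0` forces `G` linear -/

/-- `Λ(qⁿ) ≠ 0` for `n ≥ 2` when `0 < q < 1` and `L = q + q⁻¹`: `qⁿ ∉ {1, q, q⁻¹}`. [folklore] -/
theorem lambda_pow_ne_zero {q : ℝ} (hq0 : 0 < q) (hq1 : q < 1) {n : ℕ} (hn : 2 ≤ n) :
    ((q : ℂ) ^ n) ^ 3 - ((q : ℂ) + (q : ℂ)⁻¹ + 1) * ((q : ℂ) ^ n) ^ 2 +
      ((q : ℂ) + (q : ℂ)⁻¹ + 1) * (q : ℂ) ^ n - 1 ≠ 0 := by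
  have hqn_lt_q : q ^ n < q := by
    calc q ^ n ≤ q ^ 2 := pow_le_pow_of_le_one hq0.le hq1.le hn
      _ < q := by nlinarith
  have hqn_pos : 0 < q ^ n := pow_pos hq0 n
  have hq_ne : (q : ℂ) ≠ 0 := by exact_mod_cast hq0.ne'
  -- factor: Λ(t) = (t - 1)(t - q)(t - q⁻¹) with t = qⁿ
  have hfac : ((q : ℂ) ^ n) ^ 3 - ((q : ℂ) + (q : ℂ)⁻¹ + 1) * ((q : ℂ) ^ n) ^ 2 +
      ((q : ℂ) + (q : ℂ)⁻¹ + 1) * (q : ℂ) ^ n - 1 =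
      ((q : ℂ) ^ n - 1) * ((q : ℂ) ^ n - q) * ((q : ℂ) ^ n - (q : ℂ)⁻¹) := by
    field_simp
    ring
  rw [hfac]
  refine mul_ne_zero (mul_ne_zero ?_ ?_) ?_
  · have : (q : ℝ) ^ n ≠ 1 := by nlinarith
    exact_mod_cast sub_ne_zero.mpr this
  · have : (q : ℝ) ^ n ≠ q := hqn_lt_q.ne
    exact_mod_cast sub_ne_zero.mpr this
  · have hlt : (q : ℝ) ^ n < q⁻¹ := by
      have : (1 : ℝ) < q⁻¹ := (one_lt_inv₀ hq0).mpr hq1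
      linarith
    have : (q : ℝ) ^ n ≠ q⁻¹ := hlt.ne
    have h' : ((q : ℂ) ^ n) ≠ ((q⁻¹ : ℝ) : ℂ) := by exact_mod_cast this
    rw [Complex.ofReal_inv] at h'
    exact sub_ne_zero.mpr h'

/-- **Step 2.** If `G` is analytic at `0`, `G 0 = 0`, `0 < q < 1` is real, `L = q + q⁻¹`, and
`Ξ_{L,q} G ≡ 0` near `0`, then `G u = κ·u` near `0` with `κ = G'(0)`. [folklore] -/
theorem eventually_linear_of_goldenThirdDiff_eventually_zero {q : ℝ} (hq0 : 0 < q) (hq1 : q < 1)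
    {G : ℂ → ℂ} (hG : AnalyticAt ℂ G 0) (hG0 : G 0 = 0)
    (hΞ : ∀ᶠ u in 𝓝 (0 : ℂ), goldenThirdDiff ((q : ℂ) + (q : ℂ)⁻¹) (q : ℂ) G u = 0) :
    ∃ κ : ℂ, ∀ᶠ u in 𝓝 (0 : ℂ), G u = κ * u := by
  set B : ℂ := (q : ℂ) with hBdef
  set L : ℂ := B + B⁻¹ with hLdef
  have hB0 : B ≠ 0 := by rw [hBdef]; exact_mod_cast hq0.ne'
  set κ : ℂ := deriv G 0 with hκ
  refine ⟨κ, ?_⟩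
  -- pass to `G̃ = G − κ·id`, still killed by `Ξ`
  set Gt : ℂ → ℂ := fun w => G w - κ * w with hGt
  have hΛ : (B - 1) * (B ^ 2 - L * B + 1) = 0 := by
    rw [hLdef]; field_simp; ring
  have hΞt : ∀ᶠ u in 𝓝 (0 : ℂ), goldenThirdDiff L B Gt u = 0 := by
    filter_upwards [hΞ] with u hu
    rw [hGt, goldenThirdDiff_sub_linear L B κ G hΛ u]
    exact hu
  have hGtan : AnalyticAt ℂ Gt 0 := hG.sub (analyticAt_const.mul analyticAt_id)
  have hGt0 : Gt 0 = 0 := by simp [hGt, hG0]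
  have hGtderiv : HasDerivAt Gt 0 0 := by
    have h1 : HasDerivAt G κ 0 := hG.differentiableAt.hasDerivAt
    have h2 : HasDerivAt (fun w : ℂ => κ * w) κ 0 := by
      simpa using (hasDerivAt_id (0 : ℂ)).const_mul κ
    have h3 : HasDerivAt (fun w => G w - κ * w) (κ - κ) 0 := h1.sub h2
    rw [sub_self] at h3
    exact h3
  -- it suffices that `Gt ≡ 0` near `0`
  suffices h : ∀ᶠ u in 𝓝 (0 : ℂ), Gt u = 0 by
    filter_upwards [h] with u hu
    have : G u - κ * u = 0 := hu
    linear_combination this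
  by_contra hne
  obtain ⟨n, v, hv, hv0, hGv⟩ := hGtan.exists_eventuallyEq_pow_smul_nonzero_iff.mpr hne
  -- `n ≥ 2`
  have hn1 : n ≠ 0 := by
    rintro rfl
    have h0 : Gt 0 = ((0 : ℂ) - 0) ^ 0 • v 0 := hGv.self_of_nhds
    rw [pow_zero, one_smul, hGt0] at h0
    exact hv0 h0.symm
  have hn2 : n ≠ 1 := by
    rintro rfl
    -- derivative of `u ↦ u • v u` at `0` is `v 0 ≠ 0`, but `Gt' 0 = 0`
    have hprod : HasDerivAt (fun u : ℂ => (u - 0) ^ 1 • v u) (v 0) 0 := by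
      have h1 : HasDerivAt (fun u : ℂ => u) 1 0 := hasDerivAt_id 0
      have h2 : HasDerivAt v (deriv v 0) 0 := hv.differentiableAt.hasDerivAt
      have := h1.mul h2
      simp only [one_mul, zero_mul, add_zero] at this
      refine this.congr_of_eventuallyEq ?_
      exact Eventually.of_forall fun u => by simp [smul_eq_mul]
    have hGt' : HasDerivAt Gt (v 0) 0 := hprod.congr_of_eventuallyEq hGv
    exact hv0 (hGt'.unique hGtderiv)
  have hn : 2 ≤ n := by omega
  -- normal form at the rescaled points
  have hmul : ∀ a : ℂ, Tendsto (fun u : ℂ => u * a) (𝓝 0) (𝓝 0) := fun a => by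
    have hc : Continuous (fun u : ℂ => u * a) := continuous_id.mul continuous_const
    simpa using hc.tendsto 0
  have hGv' : ∀ a : ℂ, ∀ᶠ u in 𝓝 (0 : ℂ), Gt (u * a) = (u * a - 0) ^ n • v (u * a) :=
    fun a => (hmul a).eventually hGv
  set W : ℂ → ℂ := fun u =>
    (B ^ 3) ^ n * v (u * B ^ 3) - (L + 1) * (B ^ 2) ^ n * v (u * B ^ 2) +
      (L + 1) * B ^ n * v (u * B) - v u with hW
  have hfact : ∀ᶠ u in 𝓝 (0 : ℂ), goldenThirdDiff L B Gt u = u ^ n * W u := by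
    filter_upwards [hGv, hGv' B, hGv' (B ^ 2), hGv' (B ^ 3)] with u e0 e1 e2 e3
    simp only [goldenThirdDiff, e0, e1, e2, e3, smul_eq_mul, sub_zero, hW, mul_pow]
    ring
  have hWz : ∀ᶠ u in 𝓝[≠] (0 : ℂ), W u = 0 := by
    have h := hΞt.and hfact
    rw [eventually_nhdsWithin_iff]
    filter_upwards [h] with u hu hu0
    have h' : u ^ n * W u = 0 := by rw [← hu.2]; exact hu.1
    exact (mul_eq_zero.mp h').resolve_left (pow_ne_zero _ hu0)
  have hWan : AnalyticAt ℂ W 0 := by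
    have h : ∀ a : ℂ, AnalyticAt ℂ (fun u => v (u * a)) 0 := fun a =>
      hv.comp_of_eq (analyticAt_id.mul analyticAt_const) (by simp)
    exact (((analyticAt_const.mul (h _)).sub (analyticAt_const.mul (h _))).add
      (analyticAt_const.mul (h _))).sub hv
  have hW0 : W 0 = 0 := by
    have t1 : Tendsto W (𝓝[≠] 0) (𝓝 (W 0)) := hWan.continuousAt.tendsto.mono_left nhdsWithin_le_nhds
    have t2 : Tendsto W (𝓝[≠] 0) (𝓝 0) :=
      tendsto_const_nhds.congr' (hWz.mono fun u hu => hu.symm)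
    exact tendsto_nhds_unique t1 t2
  have hW0' : W 0 = v 0 * ((B ^ n) ^ 3 - (L + 1) * (B ^ n) ^ 2 + (L + 1) * B ^ n - 1) := by
    simp only [hW, zero_mul]
    ring
  have hΛn : (B ^ n) ^ 3 - (L + 1) * (B ^ n) ^ 2 + (L + 1) * B ^ n - 1 = 0 := by
    have h := hW0
    rw [hW0'] at h
    exact (mul_eq_zero.mp h).resolve_left hv0
  have hne' := lambda_pow_ne_zero hq0 hq1 hn
  apply hne'
  rw [hBdef, hLdef] at hΛn
  linear_combination hΛn

/-! ## The rigidity theorem -/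

/-- **Golden rigidity.** Let `p ≥ 1`, `α, α₀ ∈ ℂ` (any linear jet) and `g` analytic at `0` with
`g 0 = 0`. If for infinitely many `m` the four even Fibonacci numbers `F₂ₘ, F₂₍ₘ₊ₚ₎, F₂₍ₘ₊₂ₚ₎, F₂₍ₘ₊₃ₚ₎`
are all hits of `αN + α₀ + g(1/N)`, then `g(z(u)) = κ·u` near `u = 0` for some `κ ∈ ℂ`, where
`z(u) = √5u/(1 − u²)` — i.e. `g` is `κ` times the (algebraic) golden germ near `0`. In particular a
transcendental tail has only finitely many such 4-progressions of Fibonacci hits, for every `p`.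
[folklore] -/
theorem golden_rigidity (p : ℕ) (hp : 1 ≤ p) (α α₀ : ℂ) {g : ℂ → ℂ} (hg : AnalyticAt ℂ g 0)
    (hg0 : g 0 = 0)
    (hS : ∃ᶠ m : ℕ in atTop, ∀ r : ℕ, r ≤ 3 → ∃ L : ℤ,
      α * (Nat.fib (2 * (m + r * p)) : ℂ) + α₀ + g ((Nat.fib (2 * (m + r * p)) : ℂ))⁻¹ = L) :
    ∃ κ : ℂ, ∀ᶠ u in 𝓝 (0 : ℂ), g (goldenZ u) = κ * u := by
  have hq0 : 0 < ψ ^ (2 * p) := by rw [pow_mul]; exact pow_pos goldenConj_sq_pos p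
  have hq1 : ψ ^ (2 * p) < 1 := by
    rw [pow_mul]
    exact pow_lt_one₀ goldenConj_sq_pos.le goldenConj_sq_lt_one (by omega)
  have hG : AnalyticAt ℂ (fun u => g (goldenZ u)) 0 := by
    simpa using analyticAt_comp_goldenZ_mul hg 1
  have hG0 : (fun u => g (goldenZ u)) 0 = 0 := by simp [goldenZ_zero, hg0]
  have hΞ := goldenThirdDiff_eventually_zero p α α₀ hg hS
  -- identify the parameters: `q = ψ^{2p}` (real), `L₂ₚ = q + q⁻¹`
  have hq : (((ψ : ℝ) : ℂ) ^ (2 * p)) = ((ψ ^ (2 * p) : ℝ) : ℂ) := (Complex.ofReal_pow _ _).symm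
  have hφψ : ((φ : ℝ) : ℂ) ^ 2 * ((ψ : ℝ) : ℂ) ^ 2 = 1 := by
    have h := congrArg (fun t : ℝ => (t : ℂ)) goldenRatio_sq_mul_goldenConj_sq
    simp only [Complex.ofReal_mul, Complex.ofReal_pow, Complex.ofReal_one] at h
    exact h
  have hxy : ((φ : ℝ) : ℂ) ^ (2 * p) * ((ψ : ℝ) : ℂ) ^ (2 * p) = 1 := by
    rw [pow_mul, pow_mul, ← mul_pow, hφψ, one_pow]
  have hx : ((φ : ℝ) : ℂ) ^ (2 * p) = (((ψ : ℝ) : ℂ) ^ (2 * p))⁻¹ := eq_inv_of_mul_eq_one_left hxy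
  have hL : (lucasEven p : ℂ) = ((ψ ^ (2 * p) : ℝ) : ℂ) + ((ψ ^ (2 * p) : ℝ) : ℂ)⁻¹ := by
    rw [lucasEven_cast, hx, ← hq, add_comm]
  rw [hq, hL] at hΞ
  exact eventually_linear_of_goldenThirdDiff_eventually_zero hq0 hq1 hG hG0 hΞ

end

end Literature.NumberTheory.Transcendental
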